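import Literature.Geometry.Riemannian.ExpMapLocalDiffeo
import Literature.Geometry.Lorentzian.GeodesicMaximalFlow
import Literature.Geometry.Lorentzian.LeviCivitaProofs
import Mathlib.Topology.Compactness.Lindelof
import HarnessLib

/-!
# A connected Hausdorff manifold carrying a `C¹` connection is second countable
# (Geroch 1968, Appendix; Kobayashi–Nomizu)

R. Geroch, *Spinor structure of space-times in general relativity. I*, J. Math. Phys. 9 (1968)
1739–1744, Appendix: *a connected Hausdorff manifold admitting a Lorentz metric is paracompact*
(hence second countable) — the reason no countability axiom is postulated for spacetimes, and
the step *"`M̃` is second countable: this follows directly from a theorem of Geroch"* in the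
construction of the maximal globally hyperbolic development as a union / quotient of a family of
developments (Sbierski, Ann. Henri Poincaré 17 (2016), §3.3, last bullet of the proof of
Thm. 2.8; Choquet-Bruhat–Geroch, Comm. Math. Phys. 14 (1969), proof of Thm. 3, the union of a
chain of developments). At that point of the construction the glued space carries a Lorentz
metric but **no time orientation yet** (a smooth future-directed field on a union of developments
is obtained from the consistent choice of future cones by a partition of unity, which presupposes
paracompactness), so the auxiliary-Riemannian-metric proof of the time-oriented case
(`TimeOrientation.secondCountableTopology`, `TimeOrientedSecondCountable`) does not apply; this
file proves the general statement, in the form of Kobayashi–Nomizu (*Foundations of Differential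
Geometry* I): **a connected Hausdorff manifold without boundary, modelled on a finite-dimensional
space, carrying a `C¹` covariant derivative on its tangent bundle, is second countable**
(`secondCountableTopology_of_covariantDerivative`); hence so is one carrying a `Cⁿ`, `n ≥ 2`,
pseudo-Riemannian — e.g. Lorentzian — metric (`PseudoRiemannianMetric.secondCountableTopology_of_connected`,
`PseudoRiemannianMetric.secondCountableTopology_euclidean`), via its Levi-Civita connection
(`isLocallyContMDiff_leviCivita_holds`).

Proof (geodesic reachability, over the tree's maximal geodesic flow `GeodesicMaximalFlow` and
the local diffeomorphism property of the exponential map `ExpMapLocalDiffeo`). Fix `p₀` and let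
`Wₖ` be the set of points reached from `p₀` in `k` steps "pass to a point `γ_p(t)` of the maximal
geodesic of a tangent vector `p` at the current point" (`geodesicStep`):

* `isLindelof_geodesicStep` — each step preserves the Lindelöf property: a Lindelöf set is covered
  by countably many chart domains, the tangent bundle over their union is second countable
  (`secondCountableTopology_tangentBundle_chart`: it is a countable union of sources of charts of
  `TM`), so the part of the open flow domain over the set is Lindelöf, and the flow
  `(p, t) ↦ γ_p(t)` is continuous there (`isOpen_continuousOn_maximalGeodesic`); hence
  `W = ⋃ Wₖ` is Lindelöf;
* `exists_nhds_subset_image_expMap` — every `y` has a neighbourhood inside `exp_y(𝓔_y)`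
  (`isLocalDiffeomorphAt_expMap_zero_of_le`); so `W` is open, and closed
  (`mem_geodesicStep_of_expMap`: if `z = exp_y(v)` then `y = γ_{(z, γ_v'(1))}(-1)`, the flow
  property `maximalGeodesicDomain_tangentLift_eq`), hence `W = M` by connectedness;
* a Lindelöf manifold is second countable (`ChartedSpace.secondCountable_of_countable_cover`).

One definition with body (`geodesicStep`); no named facts.

## References

* R. Geroch, *Spinor structure of space-times in general relativity. I*, J. Math. Phys. 9
  (1968) 1739–1744, Appendix.
* S. Kobayashi, K. Nomizu, *Foundations of Differential Geometry*, Vol. I, Interscience 1963,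
  Appendix (a connected manifold with a connection satisfies the second axiom of countability).
* J. Sbierski, Ann. Henri Poincaré 17 (2016) 301–329 = arXiv:1309.7591v3, §3.3.
* J. M. Lee, *Introduction to Riemannian Manifolds*, 2nd ed. (2018), Prop. 5.19 (the exponential
  map is a local diffeomorphism at `0`).
-/

noncomputable section

open Bundle Set Function Filter TopologicalSpace Topology
open scoped Manifold ContDiff Topology

namespace Literature.Geometry.Lorentzian

open Literature.Geometry.Riemannian

variable {E : Type*} [NormedAddCommGroup E] [NormedSpace ℝ E] {H : Type*} [TopologicalSpace H]
  {I : ModelWithCorners ℝ E H} {M : Type*} [TopologicalSpace M] [ChartedSpace H M]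
  [IsManifold I ∞ M] [FiniteDimensional ℝ E] [CompleteSpace E] [T2Space M]
  [BoundarylessManifold I M]
  {cov : CovariantDerivative I E (TangentSpace I : M → Type _)}
  [CovariantDerivative.ContMDiffCovariantDerivative cov 1]

/-! ### The tangent bundle over a chart domain is second countable -/

omit [IsManifold I ∞ M] [FiniteDimensional ℝ E] [CompleteSpace E] [T2Space M]
  [BoundarylessManifold I M] [CovariantDerivative.ContMDiffCovariantDerivative cov 1] in
/-- **The part of `TM` over a chart domain is second countable** (it is the source of a chart of
`TM`, homeomorphic to an open subset of `H × E`). [folklore] -/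
theorem secondCountableTopology_tangentBundle_chart [SecondCountableTopology H]
    [SecondCountableTopology E] [IsManifold I 1 M] (x : M) :
    SecondCountableTopology {p : TangentBundle I M | p.proj ∈ (chartAt H x).source} := by
  haveI : SecondCountableTopology (ModelProd H E) :=
    inferInstanceAs (SecondCountableTopology (H × E))
  have h := (chartAt (ModelProd H E) (⟨x, 0⟩ : TangentBundle I M)).secondCountableTopology_source
  have hs : (chartAt (ModelProd H E) (⟨x, 0⟩ : TangentBundle I M)).source =
      {p : TangentBundle I M | p.proj ∈ (chartAt H x).source} := by
    ext p
    exact TangentBundle.mem_chart_source_iff p ⟨x, 0⟩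
  rw [hs] at h
  exact h

/-! ### Geodesic reachability -/

variable (cov) in
/-- One step of geodesic reachability: the points `γ_p(t)` (`t` in the domain of the maximal
geodesic `γ_p`) on the maximal geodesics issuing from tangent vectors `p` over `A` — the sets
iterated in Geroch's / Kobayashi–Nomizu's countability argument. [cite: Geroch1968JMP, Appendix] -/
def geodesicStep (A : Set M) : Set M :=
  (fun q : TangentBundle I M × ℝ ↦ maximalGeodesic cov q.1.proj q.1.snd q.2) ''
    ({q : TangentBundle I M × ℝ | q.2 ∈ maximalGeodesicDomain cov q.1.proj q.1.snd} ∩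
      {q | q.1.proj ∈ A})

omit [CompleteSpace E] [T2Space M] [BoundarylessManifold I M]
  [CovariantDerivative.ContMDiffCovariantDerivative cov 1] in
/-- Reachability is monotone in the set of starting points. [folklore] -/
theorem geodesicStep_mono {A B : Set M} (h : A ⊆ B) : geodesicStep cov A ⊆ geodesicStep cov B :=
  image_mono (inter_subset_inter_right _ fun _ hq ↦ h hq)

/-- Every point is reachable from itself (time `0`). [folklore] -/
theorem subset_geodesicStep (A : Set M) : A ⊆ geodesicStep cov A := fun x hx ↦ by
  obtain ⟨-, h0, hx0, -⟩ := maximalGeodesic_spec (hasMaximalGeodesic (cov := cov) x (0 : TangentSpace I x))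
  exact ⟨(⟨x, 0⟩, 0), ⟨h0, hx⟩, hx0⟩

/-- **Geodesic reachability is symmetric**: if `y = γ_{(x,v)}(1)`, then `x` lies on the maximal
geodesic through the tangent lift of `γ_{(x,v)}` at `1`, at parameter `-1` (flow property of
maximal geodesics, `maximalGeodesicDomain_tangentLift_eq`). [folklore] -/
theorem mem_geodesicStep_of_expMap {x : M} {v : TangentSpace I x} (hv : v ∈ expDomain cov x)
    {A : Set M} (hA : expMap cov x v ∈ A) : x ∈ geodesicStep cov A := by
  obtain ⟨-, h0, hx0, -⟩ := maximalGeodesic_spec (hasMaximalGeodesic (cov := cov) x v)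
  set p : TangentBundle I M := ⟨x, v⟩ with hp
  obtain ⟨hdom, heq⟩ := maximalGeodesicDomain_tangentLift_eq (cov := cov) p hv.2
  set p' := tangentLift I (maximalGeodesic cov x v) 1 with hp'
  have hmem : (-1 : ℝ) ∈ maximalGeodesicDomain cov p'.proj p'.snd := by
    rw [hp', show x = p.proj from rfl, show v = p.snd from rfl, hdom]
    show (-1 : ℝ) + 1 ∈ maximalGeodesicDomain cov p.proj p.snd
    rw [neg_add_cancel]; exact h0
  have hval : maximalGeodesic cov p'.proj p'.snd (-1) = x := by
    have h := heq (show (-1 : ℝ) + 1 ∈ maximalGeodesicDomain cov p.proj p.snd by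
      rw [neg_add_cancel]; exact h0)
    rw [hp', show x = p.proj from rfl, show v = p.snd from rfl, ← h]
    show maximalGeodesic cov x v (-1 + 1) = p.proj
    rw [neg_add_cancel]; exact hx0
  refine ⟨(p', -1), ⟨hmem, ?_⟩, hval⟩
  show p'.proj ∈ A
  have : p'.proj = maximalGeodesic cov x v 1 := rfl
  rw [this, ← expMap_of_mem hv]
  exact hA

/-- **Every point has a neighbourhood all of whose points reach it in one geodesic step** —
indeed a neighbourhood contained in `exp_y(𝓔_y)`, since `exp_y` is a local diffeomorphism at
`0` (`isLocalDiffeomorphAt_expMap_zero_of_le`). This is the normal-neighbourhood input of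
Geroch's argument. [cite: LeeRiemannianManifolds2018, Prop. 5.19 (d)] -/
theorem exists_nhds_subset_image_expMap (y : M) :
    ∃ V ∈ 𝓝 y, V ⊆ (fun v : E ↦ expMap cov y (show TangentSpace I y from v)) '' expDomain cov y := by
  obtain ⟨Φ, h0, heq⟩ := isLocalDiffeomorphAt_expMap_zero_of_le (cov := cov) (k := 1) le_rfl y
  set S : Set E := Φ.source ∩ expDomain cov y with hS
  have hSo : IsOpen S := Φ.open_source.inter (isOpen_expDomain (cov := cov) (k := 1) le_rfl y)
  have h0S : (0 : E) ∈ S := ⟨h0, zero_mem_expDomain (cov := cov) y⟩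
  have himg : IsOpen (Φ.toOpenPartialHomeomorph '' S) :=
    Φ.toOpenPartialHomeomorph.isOpen_image_of_subset_source hSo inter_subset_left
  have hy : y ∈ Φ.toOpenPartialHomeomorph '' S := by
    refine ⟨0, h0S, ?_⟩
    have h1 : (Φ.toOpenPartialHomeomorph : E → M) 0 = expMap cov y (show TangentSpace I y from (0 : E)) :=
      (heq h0).symm
    rw [h1]
    exact (zero_mem_expDomain_and_expMap_zero (cov := cov) y).2
  refine ⟨_, himg.mem_nhds hy, ?_⟩
  rintro _ ⟨v, hv, rfl⟩
  exact ⟨v, hv.2, heq hv.1⟩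

/-- The union of countably many open subsets, each a second countable subspace, is a second
countable subspace. [folklore] -/
theorem secondCountableTopology_iUnion_of_isOpen {X : Type*} [TopologicalSpace X]
    {U : ℕ → Set X} (hUo : ∀ m, IsOpen (U m)) (hU : ∀ m, SecondCountableTopology (U m)) :
    SecondCountableTopology (⋃ m, U m) := by
  let V : ℕ → Set (⋃ m, U m) := fun m ↦ Subtype.val ⁻¹' U m
  have hVo : ∀ m, IsOpen (V m) := fun m ↦ (hUo m).preimage continuous_subtype_val
  haveI : ∀ m, SecondCountableTopology (V m) := fun m ↦ by
    haveI := hU m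
    let e : V m ≃ₜ U m :=
      { toFun := fun z ↦ ⟨z.1.1, z.2⟩
        invFun := fun u ↦ ⟨⟨u.1, mem_iUnion.2 ⟨m, u.2⟩⟩, u.2⟩
        left_inv := fun z ↦ rfl
        right_inv := fun u ↦ rfl
        continuous_toFun :=
          (continuous_subtype_val.comp continuous_subtype_val).subtype_mk _
        continuous_invFun := (continuous_subtype_val.subtype_mk _).subtype_mk _ }
    exact e.secondCountableTopology
  have hcov : ⋃ m, V m = univ := by
    ext ⟨z, hz⟩
    simp only [mem_iUnion, mem_univ, iff_true]
    obtain ⟨m, hm⟩ := mem_iUnion.1 hz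
    exact ⟨m, hm⟩
  exact secondCountableTopology_of_countable_cover hVo hcov

/-- A subset of a set which is a second countable subspace is Lindelöf. [folklore] -/
theorem isLindelof_of_subset_of_secondCountableTopology {X : Type*} [TopologicalSpace X]
    {S T : Set X} (hT : SecondCountableTopology T) (h : S ⊆ T) : IsLindelof S := by
  have h1 : IsLindelof (Subtype.val ⁻¹' S : Set T) := HereditarilyLindelofSpace.isLindelof _
  have h2 := h1.image continuous_subtype_val
  rwa [Subtype.image_preimage_coe, inter_eq_right.2 h] at h2

/-! ### Geroch's theorem -/

/-- **Geodesic reachability preserves the Lindelöf property.** If `A ⊆ M` is Lindelöf, so is the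
set of points on maximal geodesics issuing from tangent vectors over `A`: `A` is covered by
countably many chart domains `Uₘ`, the tangent bundle over `⋃ Uₘ` is second countable
(`secondCountableTopology_tangentBundle_chart`), hence the part of the (open) flow domain over `A`
is Lindelöf, and the geodesic flow is continuous on it (`isOpen_continuousOn_maximalGeodesic`).
This is the counting step of Geroch 1968, Appendix (and of Kobayashi–Nomizu's proof that a
connected manifold with a connection is second countable). [cite: Geroch1968JMP, Appendix] -/
theorem isLindelof_geodesicStep [SecondCountableTopology H] {A : Set M} (hA : IsLindelof A) :
    IsLindelof (geodesicStep cov A) := by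
  classical
  rcases A.eq_empty_or_nonempty with rfl | ⟨x₀, hx₀⟩
  · have : geodesicStep cov (∅ : Set M) = ∅ := by
      rw [geodesicStep, image_eq_empty]
      ext q
      simp
    rw [this]
    exact isLindelof_empty
  -- countably many chart domains cover `A`
  obtain ⟨r, hrc, hAr⟩ := hA.elim_countable_subcover (fun x : M ↦ (chartAt H x).source)
    (fun x ↦ (chartAt H x).open_source) (fun x _ ↦ mem_iUnion.2 ⟨x, mem_chart_source H x⟩)
  have hrne : r.Nonempty := by
    obtain ⟨x, hx⟩ := mem_iUnion.1 (hAr hx₀)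
    obtain ⟨hxr, -⟩ := mem_iUnion.1 hx
    exact ⟨x, hxr⟩
  obtain ⟨f, hf⟩ := hrc.exists_eq_range hrne
  -- the tangent bundle over their union is second countable
  have hQ : SecondCountableTopology
      (⋃ m, {p : TangentBundle I M | p.proj ∈ (chartAt H (f m)).source}) :=
    secondCountableTopology_iUnion_of_isOpen
      (fun m ↦ (chartAt H (f m)).open_source.preimage (FiberBundle.continuous_proj E _))
      (fun m ↦ secondCountableTopology_tangentBundle_chart (I := I) (f m))
  have hT : SecondCountableTopology
      ((⋃ m, {p : TangentBundle I M | p.proj ∈ (chartAt H (f m)).source}) ×ˢ (univ : Set ℝ)) := by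
    haveI := hQ
    exact (Homeomorph.Set.prod
      (⋃ m, {p : TangentBundle I M | p.proj ∈ (chartAt H (f m)).source}) (univ : Set ℝ)).secondCountableTopology
  -- the part of the flow domain over `A` is Lindelöf
  have hsub : ({q : TangentBundle I M × ℝ | q.2 ∈ maximalGeodesicDomain cov q.1.proj q.1.snd} ∩
      {q | q.1.proj ∈ A}) ⊆
      (⋃ m, {p : TangentBundle I M | p.proj ∈ (chartAt H (f m)).source}) ×ˢ (univ : Set ℝ) := by
    rintro q ⟨-, hq⟩
    refine ⟨?_, mem_univ _⟩
    obtain ⟨x, hx⟩ := mem_iUnion.1 (hAr hq)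
    obtain ⟨hxr, hqx⟩ := mem_iUnion.1 hx
    rw [hf] at hxr
    obtain ⟨m, rfl⟩ := hxr
    exact mem_iUnion.2 ⟨m, hqx⟩
  have hS := isLindelof_of_subset_of_secondCountableTopology hT hsub
  exact hS.image_of_continuousOn
    ((isOpen_continuousOn_maximalGeodesic (cov := cov)).2.mono inter_subset_left)

/-- **Geroch's theorem (Kobayashi–Nomizu form): a connected Hausdorff manifold without boundary,
modelled on a finite-dimensional space, which carries a `C¹` covariant derivative on its tangent
bundle is second countable.** Geroch, J. Math. Phys. 9 (1968) 1739, Appendix (stated for a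
Lorentz metric; the same holds for any affine connection — Kobayashi–Nomizu, *Foundations of
Differential Geometry* I): no countability axiom has to be postulated for spacetimes. This is the
form needed for the union / quotient of a family of developments in the construction of the
maximal globally hyperbolic development (Choquet-Bruhat–Geroch 1969, proof of Thm. 3; Sbierski
2016, §3.3: *"`M̃` is second countable: this follows directly from a theorem of Geroch"*), where a
time orientation of the glued space is not yet available (the time-oriented case, via an auxiliary
Riemannian metric, is `TimeOrientation.secondCountableTopology`, `TimeOrientedSecondCountable`).

Proof (geodesic reachability). Fix `p₀` and let `Wₖ` be the set of points reachable from `p₀`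
by `k` steps "move to a point of a maximal geodesic issuing from a tangent vector at the current
point" (`geodesicStep`). Each `Wₖ` is Lindelöf (`isLindelof_geodesicStep`, by induction), so
`W = ⋃ Wₖ` is Lindelöf. `W` is open and closed: every `y` has a neighbourhood `V ⊆ exp_y(𝓔_y)`
(`exists_nhds_subset_image_expMap`, the exponential map being a local diffeomorphism at `0`,
`isLocalDiffeomorphAt_expMap_zero_of_le`), so `y ∈ Wₖ` gives `V ⊆ W_{k+1}`, and `y ∈ W̄` gives a
`z = exp_y(v) ∈ V ∩ Wₖ`, whence `y = γ_{(z, γ'_v(1))}(-1) ∈ W_{k+1}` (reachability is symmetric,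
`mem_geodesicStep_of_expMap`). By connectedness `W = M`, so `M` is Lindelöf, and a Lindelöf
manifold is second countable (countably many chart domains,
`ChartedSpace.secondCountable_of_countable_cover`). [cite: Geroch1968JMP, Appendix] -/
theorem secondCountableTopology_of_covariantDerivative [SecondCountableTopology H]
    [ConnectedSpace M] (cov : CovariantDerivative I E (TangentSpace I : M → Type _))
    [CovariantDerivative.ContMDiffCovariantDerivative cov 1] : SecondCountableTopology M := by
  classical
  obtain ⟨p₀⟩ : Nonempty M := inferInstance
  -- the reachable sets
  set W : ℕ → Set M := fun k ↦ (geodesicStep cov)^[k] {p₀} with hWdef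
  have hWsucc : ∀ k, W (k + 1) = geodesicStep cov (W k) := fun k ↦
    Function.iterate_succ_apply' (geodesicStep cov) k {p₀}
  have hW : ∀ k, IsLindelof (W k) := by
    intro k
    induction k with
    | zero => exact isLindelof_singleton
    | succ k ih => rw [hWsucc]; exact isLindelof_geodesicStep ih
  have hp₀ : p₀ ∈ ⋃ k, W k := mem_iUnion.2 ⟨0, mem_singleton p₀⟩
  -- `⋃ W k` is open …
  have hopen : IsOpen (⋃ k, W k) := by
    rw [isOpen_iff_mem_nhds]
    intro y hy
    obtain ⟨k, hk⟩ := mem_iUnion.1 hy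
    obtain ⟨V, hV, hVsub⟩ := exists_nhds_subset_image_expMap (cov := cov) y
    refine mem_of_superset hV fun z hz ↦ mem_iUnion.2 ⟨k + 1, ?_⟩
    obtain ⟨v, hv, rfl⟩ := hVsub hz
    have hstep : expMap cov y (show TangentSpace I y from v) ∈ geodesicStep cov (W k) :=
      geodesicStep_mono (singleton_subset_iff.2 hk)
        ⟨(⟨y, show TangentSpace I y from v⟩, 1), ⟨hv.2, rfl⟩, (expMap_of_mem hv).symm⟩
    rw [hWsucc k]
    exact hstep
  -- … and closed
  have hclosed : IsClosed (⋃ k, W k) := by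
    rw [← closure_subset_iff_isClosed]
    intro y hy
    obtain ⟨V, hV, hVsub⟩ := exists_nhds_subset_image_expMap (cov := cov) y
    obtain ⟨z, hzV, hzW⟩ := mem_closure_iff_nhds.1 hy V hV
    obtain ⟨k, hk⟩ := mem_iUnion.1 hzW
    obtain ⟨v, hv, rfl⟩ := hVsub hzV
    refine mem_iUnion.2 ⟨k + 1, ?_⟩
    rw [hWsucc k]
    exact mem_geodesicStep_of_expMap hv hk
  -- hence everything, which is therefore Lindelöf
  have huniv : (⋃ k, W k) = univ := IsClopen.eq_univ ⟨hclosed, hopen⟩ ⟨p₀, hp₀⟩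
  have hLind : IsLindelof (univ : Set M) := by rw [← huniv]; exact isLindelof_iUnion hW
  obtain ⟨r, hrc, hcover⟩ := hLind.elim_countable_subcover (fun x : M ↦ (chartAt H x).source)
    (fun x ↦ (chartAt H x).open_source) (fun x _ ↦ mem_iUnion.2 ⟨x, mem_chart_source H x⟩)
  exact ChartedSpace.secondCountable_of_countable_cover H
    (univ_subset_iff.1 hcover) hrc

/-! ### Corollaries for metrics: Geroch's appendix theorem -/

omit [CovariantDerivative.ContMDiffCovariantDerivative cov 1] in
/-- **A connected Hausdorff manifold without boundary carrying a `Cⁿ` pseudo-Riemannian metric,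
`n ≥ 2` — in particular a Lorentz metric, with or without time orientation — is second
countable** (Geroch 1968, Appendix: *"a connected Hausdorff manifold admitting a Lorentz metric is
paracompact"*; Marathe 1972 for arbitrary signature): the Levi-Civita connection is `C¹`
(`isLocallyContMDiff_leviCivita_holds`) and `secondCountableTopology_of_covariantDerivative`
applies. [cite: Geroch1968JMP, Appendix] -/
theorem PseudoRiemannianMetric.secondCountableTopology_of_connected [SecondCountableTopology H]
    [ConnectedSpace M] {n : ℕ∞ω} [Fact (1 ≤ n)]
    (g : PseudoRiemannianMetric I n E (TangentSpace I : M → Type _)) [g.HasLeviCivita]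
    (hn : 2 ≤ n) : SecondCountableTopology M := by
  haveI : CovariantDerivative.ContMDiffCovariantDerivative g.leviCivita 1 :=
    ⟨g.isLocallyContMDiff_leviCivita_holds 1
      (by rw [show ((1 : ℕ∞) : ℕ∞ω) + 1 = 2 by norm_num]; exact hn) univ isOpen_univ⟩
  exact secondCountableTopology_of_covariantDerivative g.leviCivita

/-- **Geroch's theorem for manifolds modelled on `ℝᵈ`**: a connected Hausdorff `C^∞` manifold
modelled on `EuclideanSpace ℝ (Fin d)` carrying a `Cⁿ` pseudo-Riemannian (e.g. Lorentzian)
metric, `n ≥ 2`, is second countable — the countability field of `LorentzianManifold` /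
`Spacetime` is automatic, and so is the second countability of a glued spacetime before any time
orientation is chosen on it. [cite: Geroch1968JMP, Appendix] -/
theorem PseudoRiemannianMetric.secondCountableTopology_euclidean {d : ℕ} {n : ℕ∞ω} {N : Type*}
    [TopologicalSpace N] [ChartedSpace (EuclideanSpace ℝ (Fin d)) N] [IsManifold (𝓡 d) ∞ N]
    [T2Space N] [ConnectedSpace N] [Fact (1 ≤ n)]
    (g : PseudoRiemannianMetric (𝓡 d) n (EuclideanSpace ℝ (Fin d))
      (TangentSpace (𝓡 d) : N → Type _)) [g.HasLeviCivita] (hn : 2 ≤ n) :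
    SecondCountableTopology N :=
  g.secondCountableTopology_of_connected hn

end Literature.Geometry.Lorentzian

end
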